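import Summits.BirchSwinnertonDyer.Rank1Residual.X12.ClassClosureO10RubinEta
import Summits.BirchSwinnertonDyer.Rank1Residual.X12.InertBadGoodTwist
import Summits.BirchSwinnertonDyer.Rank1Residual.Additive.QuadraticBranchSignedMainConjecture
import Summits.BirchSwinnertonDyer.Rank1Residual.Partition.MainConjecturesCMInert
import HarnessLib

/-!
# Class X12, residual class O10, sub-class O10-PS (CM, `r_an = 1`, `p ≥ 5` inert and BAD, Kodaira
# `I₀*` at `p`): the class target `LowerHalfOnType p I₀*` FROM the two typed inputs (C1_η) ∧ (C2_η)
# of the quadratic `η`-branch frame (cell `b2b-bsdres`, lane CLASS-CLOSURE §3.14, seat cc-typer-6)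

HONEST FRAMING (run/shared/lean/b2b/bsd-rank1-residual/, verbatim in every file): the goal of the
cell is to DELETE the COMBINATION-SHAPED residual classes of the Birch–Swinnerton-Dyer formula for
ALL analytic-rank `≤ 1` elliptic curves over `ℚ` — "full BSD formula for every rank `≤ 1` curve in
class `C`" assembled STRICTLY from published theorems — so that the rank-`≤ 1` remainder becomes
exactly the CONSTRUCTION-SHAPED classes, which are TYPED (missing-input `Prop`s), NOT attempted.
This is not "finishing BSD". Research route; NO CLAIM BEYOND STATED CLASSES; X12 / O10 stay
CONSTRUCTION-SHAPED and OPEN; nothing here changes a label or a mark; census / instrument output is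
EVIDENCE, never a Literature fact. THEOREMS ONLY (bookkeeping over the tree's theorems); no
definition, no named fact, nothing asserted: every conclusion is CONDITIONAL on the two
`@[conjecture]` inputs of `Additive/QuadraticBranchSignedMainConjecture.lean`, taken as hypotheses.

## What (x1b gen 25's consumer request, INBOX 2026-08-21T06:56Z: "(C1_η) ∧ (C2_η) ⟹
## `LowerHalfOnType p (.Istar 0)`"; O10-O11-ANATOMY-v2.md §0 (iii), §1)

On the sub-class O10-PS = `HasSignedLocalType W p I₀*` (`X12/ClassClosureO10RubinEta.lean`: CM,
`p` inert in the CM field, bad at `p`, Kodaira symbol `I₀*` at `p`; semistability defect `e = 2`),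
`p ≥ 5`, the curve `W` is the `p*`-twist of a CM curve `V` GOOD at `p` (x1b gen 25,
`X12/InertBadGoodTwist.lean`; here via additive-p4's `I₀* ⟹ W^{(D)}` good for `p ∥ D`,
`Additive.hasGoodReductionAt_quadraticTwist_of_kodairaSymbolAt_eq_Istar_zero`, with `D = p*`), and
`a_p(V) = 0` by Deuring (`frobeniusTrace_eq_zero_of_hasCM_of_cmInert`: `V` has the same `j`, hence
CM by the same field, in which `p` is inert). So the pair `(W, p)` is in the frame of
`Additive/QuadraticBranchSignedMainConjecture.lean`:
* `exists_goodTwist_pStar_of_hasSignedLocalType_IstarZero` — the SUPPLY theorem (any rank): a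
  globally minimal `V` with `C • W^{(p*)} = V`, good at `p`, `a_p(V) = 0`, CM, `p` inert, `j(V) = j(W)`;
* `bsdp_of_hasSignedLocalType_IstarZero_of_quadraticBranch` — **(C1_η) for the CM good inert
  partners ∧ (C2_η) for the rank-one curves of type `(p, I₀*)` ⟹ Miller's `BSD(W, p)`** for every
  rank-one `W` of signed local type `(p, I₀*)`, `p ≥ 5` (modularity `hmod`, GZK `hGZK` by name; NO
  Manin datum — the print shape `PPart` is the full `p`-part);
* `lowerHalfOnType_IstarZero_of_quadraticBranch` — hence the class target
  **`LowerHalfOnType p I₀*`** (`lowerHalfOnType_of_forall_bsdp`), i.e. the O10-PS node of record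
  FROM the two typed inputs. Both inputs are NOT theorems of the published record: (C1_η) is
  Kobayashi's even main conjecture on the branch `η = ω^{(p−1)/2}` (conjecture IN PRINT; for CM
  "provable with the same proof", Pollack–Rubin 2004 p. 448, a REMARK), (C2_η) is OUR formulation of
  the unwritten branch `p`-adic Gross–Zagier link (Tian ICM 2022 p. 1993; Pan 2017 claim). Nothing
  is booked; O10 stays OPEN; the residue named for ideation is unchanged (the branch `p`-adic
  Gross–Zagier formula + the `η`-branch main conjecture for CM `V`).

References: [Kobayashi2003] §4 (p. 8), Thm. 3.2 (p. 7); [PollackRubin2004] p. 448;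
[BurungaleKobayashiOta2023] App. A Cor. A.5; [Tian2023CongruentICM] p. 1993; [SilvermanATAEC1994]
IV.9.4 Step 6; [Lang1987] Ch. 13 §4 Thm. 12 (Deuring); [Miller2011LMS] Def. 1.1.
-/

noncomputable section

open scoped Classical NumberField

open WeierstrassCurve NumberField IsDedekindDomain IsDedekindDomain.HeightOneSpectrum
  Rat.HeightOneSpectrum Literature.NumberTheory.EllipticCurves
  Literature.NumberTheory.EllipticCurves.ModularForms
  Literature.NumberTheory.EllipticCurves.Rank1Residual
  Literature.NumberTheory.EllipticCurves.Rank1Residual.Typed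
  Literature.NumberTheory.Automorphic
  Literature.NumberTheory.DiophantineGeometry
  Summit.BirchSwinnertonDyer.Rank1Residual.Additive

namespace Summit.BirchSwinnertonDyer.Rank1Residual.X12.O10

variable {p : ℕ} [hp : Fact p.Prime]

/-- **SUPPLY (any rank): a CM curve of signed local type `(p, I₀*)`, `p ≥ 5`, is the `p*`-twist of a
globally minimal CM curve `V` GOOD at `p` with `a_p(V) = 0`, `p` inert in the (same) CM field,
`j(V) = j(W)`.** Kodaira `I₀*` ⟹ `W^{(p*)}` has good reduction at `p` (`p ∥ p*`; additive-p4's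
`hasGoodReductionAt_quadraticTwist_of_kodairaSymbolAt_eq_Istar_zero`); a globally minimal model `V`
(Néron); `a_p(V) = 0` by Deuring at an inert good prime (`frobeniusTrace_eq_zero_of_hasCM_of_cmInert`).
[cite: SilvermanATAEC1994, IV.9.4 Step 6 (PDF p. 345)] [cite: Lang1987, Ch. 13 §4 Thm. 12 (PDF p. 140)] -/
theorem exists_goodTwist_pStar_of_hasSignedLocalType_IstarZero (W : WeierstrassCurve ℚ)
    [W.IsElliptic] (hT : HasSignedLocalType W p (.Istar 0)) (hp5 : 5 ≤ p) :
    ∃ (V : WeierstrassCurve ℚ) (_ : V.IsElliptic) (_ : V.IsGloballyMinimal) (C : VariableChange ℚ),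
      C • W.quadraticTwist ((-1) ^ (p / 2) * p) = V ∧ V.HasGoodReductionAtPrime p ∧
        V.frobeniusTrace p = 0 ∧ V.HasCM ∧ CMInert V p ∧ V.j = W.j := by
  have hpP : p.Prime := hp.out
  have hp2 : p ≠ 2 := by omega
  obtain ⟨hCM, hin, -, hk⟩ := hT
  obtain ⟨v, hv⟩ : ∃ v : HeightOneSpectrum (𝓞 ℚ), (primesEquiv v : ℕ) = p :=
    ⟨primesEquiv.symm ⟨p, hpP⟩, by rw [Equiv.apply_symm_apply]⟩
  have hK : W.kodairaSymbolAt v = .Istar 0 := hk v hv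
  have hv2 : (primesEquiv v : ℕ) ≠ 2 := by rw [hv]; exact hp2
  -- `p ∥ p*`
  have hu : IsUnit ((-1 : ℤ) ^ (p / 2)) := (isUnit_one.neg).pow _
  have h1 : ((primesEquiv v : ℕ) : ℤ) ∣ (-1) ^ (p / 2) * (p : ℤ) := by
    rw [hv]; exact Dvd.intro_left _ rfl
  have h2 : ¬ ((primesEquiv v : ℕ) : ℤ) ^ 2 ∣ (-1) ^ (p / 2) * (p : ℤ) := by
    rw [hv, hu.dvd_mul_left]
    intro h2
    have hp0' : (p : ℤ) ≠ 0 := by exact_mod_cast hpP.ne_zero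
    have h1 : (p : ℤ) * p ∣ (p : ℤ) * 1 := by simpa [sq] using h2
    have hp1 : (p : ℤ) ∣ 1 := (mul_dvd_mul_iff_left hp0').mp h1
    have := Int.eq_one_of_dvd_one (by positivity) hp1
    have h1' : p = 1 := by exact_mod_cast this
    exact hpP.one_lt.ne' h1'
  have hgood : (W.quadraticTwist ((((-1) ^ (p / 2) * (p : ℤ) : ℤ)) : ℚ)).HasGoodReductionAt v :=
    Additive.hasGoodReductionAt_quadraticTwist_of_kodairaSymbolAt_eq_Istar_zero v W hv2 h1 h2 hK
  have hDq : ((((-1) ^ (p / 2) * (p : ℤ) : ℤ)) : ℚ) = (-1) ^ (p / 2) * p := by push_cast; ring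
  rw [hDq] at hgood
  have hD0 : ((-1 : ℚ) ^ (p / 2) * p) ≠ 0 :=
    mul_ne_zero (pow_ne_zero _ (by norm_num)) (by exact_mod_cast hpP.ne_zero)
  obtain ⟨V, hVe, hVm, C, hC⟩ := exists_isGloballyMinimal_smul_eq_twist W hD0
  have hVgood : V.HasGoodReductionAt v := by
    rw [← hasGoodReductionAt_smul_iff_holds v V C, hC]; exact hgood
  have hVgood' : V.HasGoodReductionAtPrime p := by
    subst hv
    exact (hasGoodReductionAtPrime_iff_hasGoodReductionAt_ringOfIntegers v V).mpr hVgood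
  haveI hell : (W.quadraticTwist ((-1 : ℚ) ^ (p / 2) * p)).IsElliptic := W.isElliptic_quadraticTwist hD0
  have hj : V.j = W.j := by
    have h1 : (C • V).j = V.j := variableChange_j V C
    have h2 : (C • V).j = (W.quadraticTwist ((-1 : ℚ) ^ (p / 2) * p)).j := by
      have key : ∀ (X Y : WeierstrassCurve ℚ) (hX : X.IsElliptic) (hY : Y.IsElliptic),
          X = Y → X.j = Y.j := by
        intro X Y hX hY h; subst h; rfl
      exact key _ _ _ _ hC
    rw [← h1, h2]
    exact W.j_quadraticTwist hD0
  have hCM_V : V.HasCM := (hasCM_iff_j_mem_holds V).mpr (hj ▸ (hasCM_iff_j_mem_holds W).mp hCM)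
  have hin_V : CMInert V p := by
    unfold CMInert CMRamified CMSplit at hin ⊢
    rw [hj]; exact hin
  have hap : V.frobeniusTrace p = 0 := frobeniusTrace_eq_zero_of_hasCM_of_cmInert hCM_V hp2 hVgood' hin_V
  exact ⟨V, hVe, hVm, C⁻¹, by rw [← hC, inv_smul_smul], hVgood', hap, hCM_V, hin_V, hj⟩

/-- **(C1_η) on the CM good inert partners ∧ (C2_η) on the rank-one curves of type `(p, I₀*)` ⟹
Miller's `BSD(W, p)` for every rank-one CM curve `W` of signed local type `(p, I₀*)`, `p ≥ 5`** — the
O10-PS sub-class, pair by pair, with NO Manin datum (`Additive.bsdp_of_quadraticBranchRankOneLink`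
on the supplied partner; modularity `hmod`, GZK `hGZK` by name). CONDITIONAL on the two typed inputs
(Kobayashi's even main conjecture on the branch `η = ω^{(p−1)/2}` for the CM partner — conjecture in
print, "same proof" remark of Pollack–Rubin p. 448; and OUR branch rank-one link — unwritten);
nothing booked; O10 stays OPEN. [cite: Kobayashi2003, §4 Even main conjecture (p. 8)]
[cite: PollackRubin2004, remark on Sel over ℚ(μ_{p^∞}) (p. 448)]
[cite: BurungaleKobayashiOta2023, App. A Cor. A.5 (shape only)] [cite: Miller2011LMS, §1 and Def. 1.1] -/
theorem bsdp_of_hasSignedLocalType_IstarZero_of_quadraticBranch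
    (hmod : hasEntireLFunction_rat) (hGZK : rank_eq_analyticRank_of_analyticRank_le_one)
    (hC1 : ∀ (V : WeierstrassCurve ℚ) [V.IsElliptic] [V.IsGloballyMinimal], V.HasCM →
      V.HasGoodReductionAtPrime p → CMInert V p → QuadraticBranchPlusMainConjectureAt V p)
    (hC2 : ∀ (W : WeierstrassCurve ℚ) [W.IsElliptic] [W.IsGloballyMinimal],
      HasSignedLocalType W p (.Istar 0) → W.analyticRank = 1 → QuadraticBranchRankOneLinkAt W p)
    (W : WeierstrassCurve ℚ) [W.IsElliptic] [W.IsGloballyMinimal]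
    (hT : HasSignedLocalType W p (.Istar 0)) (hr : W.analyticRank = 1) (hp5 : 5 ≤ p) : BSDp W p := by
  obtain ⟨V, hVe, hVm, C, hC, hgood, hap, hCM, hin, -⟩ :=
    exists_goodTwist_pStar_of_hasSignedLocalType_IstarZero W hT hp5
  exact bsdp_of_quadraticBranchRankOneLink W p hmod hGZK (hC2 W hT hr) (hC1 V hCM hgood hin)
    (by omega) hC hgood hap hr

/-- **The O10-PS node of record FROM the two typed inputs: `LowerHalfOnType p I₀*`, `p ≥ 5`**
(`lowerHalfOnType_of_forall_bsdp` on the previous theorem) — x1b gen 25's requested consumer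
"`LowerHalfOnType p (.Istar 0)` ⟸ (C1_η) ∧ (C2_η)". CONDITIONAL; nothing booked; no label moves.
[cite: Kobayashi2003, §4 Even main conjecture (p. 8)] [cite: Tian2023CongruentICM, p. 1993]
[cite: Miller2011LMS, Def. 1.1] -/
theorem lowerHalfOnType_IstarZero_of_quadraticBranch
    (hmod : hasEntireLFunction_rat) (hGZK : rank_eq_analyticRank_of_analyticRank_le_one)
    (hC1 : ∀ (V : WeierstrassCurve ℚ) [V.IsElliptic] [V.IsGloballyMinimal], V.HasCM →
      V.HasGoodReductionAtPrime p → CMInert V p → QuadraticBranchPlusMainConjectureAt V p)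
    (hC2 : ∀ (W : WeierstrassCurve ℚ) [W.IsElliptic] [W.IsGloballyMinimal],
      HasSignedLocalType W p (.Istar 0) → W.analyticRank = 1 → QuadraticBranchRankOneLinkAt W p)
    (hp5 : 5 ≤ p) : LowerHalfOnType p (.Istar 0) :=
  lowerHalfOnType_of_forall_bsdp hGZK fun W _ _ hT hr ↦
    bsdp_of_hasSignedLocalType_IstarZero_of_quadraticBranch hmod hGZK hC1 hC2 W hT hr hp5

end Summit.BirchSwinnertonDyer.Rank1Residual.X12.O10

end
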